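import Summits.QuantumFields.YangMills.Theorems.BalabanUVNodesN12FlatDatumRigidity
import Summits.QuantumFields.YangMills.Theorems.UnitScaleTiltProp7FlatDatum
import Literature.MathematicalPhysics.QuantumFieldTheory.Balaban1983to89.B15Claim189PinNonVacuity
import Literature.MathematicalPhysics.QuantumFieldTheory.Balaban1983to89.B15ShellGauge193
import Literature.MathematicalPhysics.QuantumFieldTheory.Balaban1983to89.Node00.LargeFieldBackgroundCoPOfRecord
import HarnessLib

/-!
# BalabanUVNodes ∕ N12 — THE (T1@q₀)-CENTRAL ROW OF THE (J0′) PRODUCER OF RECORD HOLDS AT THE FLAT BASE FIELD `V_k ≡ 1` (its A2 inhabitant), and so does (E) with `U₀ := 1`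
# whenever the flat configuration lies in the class

[Balaban1985Variational] = «[15]», Thm 1 p. 279 («a unique critical orbit in the space (6)»), (3)–(4) p. 278; [Balaban1988Convergent] = «[III]», (2.2) p. 255, (2.10)–(2.13)
pp. 256–257; [Balaban1989LargeFieldI] = «[IV]», p. 193 (the extension `ext`), Prop. 1 p. 194; [Balaban1987RG1] (0.2), (0.4) pp. 252–253; [Balaban1985Averaging] (8), (11), (19)–(20)
pp. 18–21.

Cell `pub-ymgap` (HUMAN RULINGS D-0062 ∕ D-0149), WIDTH SEAT `pub-ymgap-dag-n12-w6` g17 (node N12 = [B15]; key K1⁹ `stmt-QuantumFields-27364`, `--kind proof --supports … --as helper`;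
count-neutral; lane word n12-c g26 «GO, WANTED» I.28810).  THEOREMS ONLY (0 `def`, 0 `instance`, 0 `sorry`).  Consumed BY NAME: this seat's RIGIDITY AT THE FLAT DATUM
(`N12FlatDatumRigidity.exists_towerCentral_gauge_to_one_of_flat_segments`), UST's `Prop7FlatDatum` (`plaqHol_eq_one_of_wilsonAction4_eq_zero`, `holFlat_of_plaqHol_eq_one`) and
`Prop7FlatHolonomy.iter_blockAvg_eq_straightIter_of_flat`, dag-n12-e's `B15Claim189PinNonVacuity` (`qsstarGIter0_one`, `wilsonAction4_unit`, `isMinimizer_one_avgFamily_one`),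
type-B15's `B15ShellGauge193.shellGauge` ∕ `B15Extension193.extend`, NODE 00's `Node00.avOfRecord` (= `blockAvg expMeanLogSU`, `rfl`).

THE ROW (dag-n12-c's (J0′) producer of record `…N12MinimiserFamilyOfClassThreshold.hMin_atRecord_of_node00Letters_thm1AtBase_central_ofClass_threshold` :173–:176, and verbatim in the
`εreg`-uniform editions U2 p724662 ∕ U3 p725063), per base field `V_k` with its (E)-minimiser `U₀`:
«`∀ U ∈ reg′, AgreeOn 𝔹 (M˙U) (M˙(Q_k^{s*}(ext V_k))) → A U ≤ A U₀ → ∃ u, (∀ j ≤ k, ∀ b ∈ bondsOf (𝔹 j), toMS u j b₋ = toMS u j b₊ ∧ ∀ g, toMS u j b₋ · g = g · toMS u j b₋) ∧ U^u = U₀`».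
THIS FILE INHABITS IT AT `V_k ≡ 1`, `U₀ := 1`, `𝔹 := 𝐁_k(Z)`, for EVERY reading class `reg′` (★★★ `thm1Row_one_at_flatDatum`): `ext 1 = 1` (the shell gauge of the flat configuration is trivial,
§1) and `Q_k^{s*} 1 = 1`, so the datum is `M˙(1)`; `A U ≤ A 1 = 0` makes every plaquette of `U` trivial, hence `U` holonomy-flat (UST, lattice Stokes); the constraint `M˙U = M˙1` on
`𝐁_k(Z)` makes the straight transporters of `U` along the constrained bonds trivial (UST: the (0.4) average of a holonomy-flat configuration IS its straight transporter); and the rigidity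
theorem supplies `u` with `u = 1` at every tower site and `U^u = 1`.  With (E) at `U₀ := 1` (★ `isMinimizer_one_at_flatDatum`, modulo the DISPLAYED membership `1 ∈ class`, which holds for
the (2.12) class of record — plaquettes and co-divergences of `1` vanish — but is not typed here) this is the non-vacuity, at the flat base field, of the two rows of the producer that speak
about the unknown minimiser.  Letter budget at the record: `d = 4`, `L ≥ 13` (`T4Family.hL11`), `k + 1 ≤ m + K` ⟹ `7·Lᵏ ≤ L^{k+1} ≤ 2L^{m+K}`.

HONEST FRAMING.  An A2 (non-vacuity) certificate for ONE displayed hypothesis-row at ONE base field, by name over landed kernel theorems; nothing of Bałaban's estimates asserted or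
refuted; `1 ∈ class` DISPLAYED in the (E) corollary; count-neutral helper; N12 NOT discharged; K1⁹ NOT closed; counts of record unmoved; one finite 𝕋⁴ programme at fixed ε — R4 closes
the conditional rung `BalabanLadder.UV` only; the Yang–Mills mass gap (Clay) is NOT proved by any of this; nothing continuum ∕ ℝ⁴ ∕ OS.
-/

noncomputable section

open scoped Matrix.Norms.L2Operator

namespace Summit.QuantumFields.YangMills.BalabanUVNodes.N12Thm1RowAtFlatDatum

open Set
open Literature.MathematicalPhysics.QuantumFieldTheory.Balaban1983to89
open Literature.MathematicalPhysics.QuantumFieldTheory.BalabanImbrieJaffe1984to88.BIJ85Eq453GaugeField (qsstarGIter0)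
open B15DeterminingSets (DetSet pts mem_pts bondsOf embIter AgreeOn avgFamily IsMinimizer)
open B14.Eq213DetSet (Bj maxDomT)
open B14.Eq213MaximalDomains (side)
open B16Sect1Backgrounds (toMS)
open B15ShellGauge193 (shellGauge)
open B15Extension193 (extend cutoff Touches extend_of_touches extend_eq_of_mem_outBonds mem_outBonds_iff_not_touches)
open T4Continuum (walk walkEnd holAt netDisp Letter)
open GaugeField (gaugeAct)
open Node00 (SU avOfRecord)
open BlockAveraging (blockAvg)
open ExpMeanLog (expMeanLogSU)
open Summit.QuantumFields.YangMills.Theorems.Prop7FlatHolonomy (iter_blockAvg_eq_straightIter_of_flat)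
open Summit.QuantumFields.YangMills.Theorems.Prop7FlatDatum (plaqHol_eq_one_of_wilsonAction4_eq_zero holFlat_of_plaqHol_eq_one)
open B15Claim189PinNonVacuity (qsstarGIter0_one wilsonAction4_unit isMinimizer_one_avgFamily_one)
open Summit.QuantumFields.YangMills.BalabanUVNodes.N12FlatDatumRigidity (exists_towerCentral_gauge_to_one_of_flat_segments)

/-! ## §1  The extension of the flat base field is flat: `ext 1 = 1` -/

section Ext

variable {P : Params} {G : Type*} [GaugeGroup G] {k : ℕ}

/-- Parallel transport of the pulled-back flat configuration along any `ℤᵈ` word is trivial ([Balaban1985Averaging] (9) for `V ≡ 1`; cf. `B8Ineq130.hol_one`).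
[cite: Balaban1985Averaging, (9) p.18 (bookkeeping)] -/
theorem hol_pull_one_eq_one : ∀ (x : Fin P.d → ℤ) (w : List (B7Prop1Explicit.Letter P.d)),
    B7Prop1Explicit.hol (T4AxialGaugeSmallField.pull (1 : GaugeField P k G)) x w = 1
  | x, [] => rfl
  | x, l :: w => by
    rw [B7Prop1Explicit.hol_cons, hol_pull_one_eq_one (x + l.vec) w, mul_one]
    show (if l.2 then T4AxialGaugeSmallField.pull (1 : GaugeField P k G) x l.1 else (T4AxialGaugeSmallField.pull (1 : GaugeField P k G) (x + l.vec) l.1)⁻¹) = 1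
    split
    · rfl
    · exact inv_one

/-- **THE SHELL GAUGE OF THE FLAT CONFIGURATION IS TRIVIAL**: the generalized axial gauge of [IV] p. 193 transports `1` along the shell paths. [cite: Balaban1989LargeFieldI, p.193] -/
theorem shellGauge_one (lo hi : Fin P.d → ℤ) : shellGauge (1 : GaugeField P k G) lo hi = fun _ => 1 := by
  funext s
  unfold shellGauge
  split
  · show B15ShellGauge193.shellFn _ lo hi _ = 1
    unfold B15ShellGauge193.shellFn
    exact hol_pull_one_eq_one _ _
  · rfl

/-- **THE EXTENSION BY THE TRIVIAL GAUGE OF THE FLAT CONFIGURATION IS FLAT**: `extend Λ 1 1 = 1` ([IV] p. 193: `V′ = 1` in `Λ`, `V^g = 1` outside, `g⁻¹ = 1`). [cite: Balaban1989LargeFieldI, p.193] -/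
theorem extend_one_one (Λ : Set (Site P k)) : extend Λ (fun _ => (1 : G)) (1 : GaugeField P k G) = 1 := by
  classical
  funext b
  have hc : ∀ y : Site P k, cutoff Λ (fun _ => (1 : G)) y = 1 := fun y => by
    unfold cutoff; split <;> rfl
  by_cases hb : Touches Λ b
  · rw [extend_of_touches _ _ hb, hc, hc, inv_one, one_mul]
    rfl
  · exact extend_eq_of_mem_outBonds _ _ ((mem_outBonds_iff_not_touches b).2 hb)

/-- Hence at the flat base field the extension of record is flat: `ext 1 = 1` for `ext W = extend Λ (shellGauge W lo hi) W`. [cite: Balaban1989LargeFieldI, p.193] -/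
theorem ext_one (Λ : Set (Site P k)) (lo hi : Fin P.d → ℤ) (ext : GaugeField P k G → GaugeField P k G)
    (hext : ∀ W, ext W = extend Λ (shellGauge W lo hi) W) : ext 1 = 1 := by
  rw [hext, shellGauge_one, extend_one_one]

end Ext

/-! ## §2  The flat configuration lies in the (2.12) class of record (plaquettes and co-divergences of `1` vanish) -/

section ClassOfRecord

variable {P : Params} {N : ℕ} [NeZero N] {j : ℕ}

/-- The embedded plaquette matrix of the flat configuration is `1`. [cite: Balaban1985RegularSpaces, (1.2) p.76 (bookkeeping)] -/
theorem plaqMat_one (x : Site P j) (μ ν : Fin P.d) (h : μ < ν) : Node00.Sect2.plaqMat (1 : GaugeField P j (SU N)) x μ ν h = 1 := by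
  unfold Node00.Sect2.plaqMat
  rw [B15Chi124DetSets.plaqHol_one, map_one, Units.val_one]

/-- Every term of the co-divergence (1.2) of the flat configuration vanishes. [cite: Balaban1985RegularSpaces, (1.1)–(1.2) p.76] -/
theorem coDivTerm_one (x : Site P j) (ν α β : Fin P.d) (h : α < β) : Node00.Sect2.coDivTerm (1 : GaugeField P j (SU N)) x ν α β h = 0 := by
  unfold Node00.Sect2.coDivTerm
  rw [plaqMat_one, plaqMat_one]
  have e : ((1 : GaugeField P j (SU N)) ⟨x.unshift ν, ν⟩) = 1 := rfl
  rw [e, inv_one, map_one, Units.val_one, one_mul, mul_one, sub_self]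

/-- The co-divergence `η·(D^{η*}_U ∂U)` of the flat configuration vanishes at every bond. [cite: Balaban1985RegularSpaces, (1.2) p.76, (1.9) p.77] -/
theorem coDivSum_one (x : Site P j) (μ : Fin P.d) : Node00.Sect2.coDivSum (1 : GaugeField P j (SU N)) x μ = 0 := by
  unfold Node00.Sect2.coDivSum
  refine Finset.sum_eq_zero fun ν _ => ?_
  split_ifs <;> simp [coDivTerm_one]

/-- (1.9) holds for the flat configuration on every bond set at every positive threshold. [cite: Balaban1985RegularSpaces, (1.9) p.77] -/
theorem coDivSmallOn_one {S : Set (PBond P j)} {δ : ℝ} (hδ : 0 < δ) : Node00.Sect2.CoDivSmallOn S δ (1 : GaugeField P j (SU N)) := fun b _ => by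
  rw [coDivSum_one]; simpa using hδ

/-- (1.7) holds for the flat configuration on every plaquette set at every positive threshold. [cite: Balaban1985RegularSpaces, (1.7) p.77] -/
theorem plaqSmallOn_one {G : Type*} [GaugeGroup G] {S : Set (Plaq P j)} {δ : ℝ} (hδ : 0 < δ) : PlaqSmallOn S δ (1 : GaugeField P j G) := fun p _ => by
  rw [B15Chi124DetSets.plaqHol_one, GaugeGroup.dist1_one]; exact hδ

variable {F : T4Continuum.T4Family}

/-- **THE FLAT CONFIGURATION LIES IN THE (2.12) CLASS on every support** (`εreg > 0`): its plaquettes are `1` and its co-divergences vanish.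
[cite: Balaban1985Variational, (2) p.278; Balaban1985RegularSpaces, (1.7)–(1.9) p.77; Balaban1988Convergent, (2.12) p.256] -/
theorem one_mem_regMSCoPOfRecordAt (ν : Node00.Stage7Numerics) (hreg : 0 < ν.εreg) (K k : ℕ) (Ω₀ : Set (Site (F.P K) 0)) (Ω : ℕ → Set (Site (F.P K) 0)) :
    (1 : GaugeField (F.P K) 0 (SU N)) ∈ Node00.regMSCoPOfRecordAt F N ν K k Ω₀ Ω := by
  rw [Node00.mem_regMSCoPOfRecordAt_iff]
  have hη : ∀ j, 0 < (F.P K).eta j := fun j => by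
    unfold Params.eta
    exact pow_pos (inv_pos.mpr (Nat.cast_pos.mpr (F.P K).L_pos)) j
  exact ⟨fun j _ => plaqSmallOn_one (mul_pos hreg (pow_pos (hη j) 2)), fun j _ => coDivSmallOn_one (mul_pos hreg (pow_pos (hη j) 3))⟩

/-- **THE FLAT CONFIGURATION LIES IN THE CLASS OF RECORD** (`εreg > 0`). [cite: Balaban1985Variational, (2) p.278; Balaban1988Convergent, (2.12) p.256] -/
theorem one_mem_regMSCoPOfRecord (ν : Node00.Stage7Numerics) (hreg : 0 < ν.εreg) (K k : ℕ) (Ω : ℕ → Set (Site (F.P K) 0)) :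
    (1 : GaugeField (F.P K) 0 (SU N)) ∈ Node00.regMSCoPOfRecord F N ν K k Ω :=
  one_mem_regMSCoPOfRecordAt ν hreg K k _ Ω

end ClassOfRecord

/-! ## §3  At the record: `A(U) ≤ A(1)` makes `U` holonomy-flat; the constraint `M˙U = M˙1` on `𝐁_k(Z)` makes its straight transporters trivial -/

section Record

variable {F : T4Continuum.T4Family} {N : ℕ} [NeZero N] {Kt : ℕ}

/-- The trivial configuration has trivial holonomy along every step sequence (private bookkeeping; the Spine's `…NE7.holAt_one` is not importable into `Theorems`).
[cite: Balaban1985Averaging, (9) p.19 (bookkeeping)] -/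
private theorem holAt_one_eq_one' {P : Params} {G : Type*} [GaugeGroup G] {j : ℕ} : ∀ γ : List (T4Continuum.LStep P j), holAt (1 : GaugeField P j G) γ = 1
  | [] => T4Continuum.holAt_nil _
  | s :: γ => by
    rw [T4Continuum.holAt_cons, holAt_one_eq_one' γ, mul_one]
    show (if s.fwd then (1 : G) else (1 : G)⁻¹) = 1
    split <;> simp

/-- **`A(U) ≤ A(1) = 0` ⇒ HOLONOMY-FLAT** on `SU(N)`: every plaquette of `U` is trivial (`A ≥ 0` termwise, [Balaban1987RG1] (0.2)), hence so is the holonomy along every word of zero net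
displacement (lattice Stokes, UST `holFlat_of_plaqHol_eq_one`). [cite: Balaban1987RG1, (0.2) p.252; Balaban1985Averaging, (19)–(20) p.21] -/
theorem holFlat_of_wilsonAction4_le_one (U : GaugeField (F.P Kt) 0 (SU N)) (hA : wilsonAction4 U ≤ wilsonAction4 (1 : GaugeField (F.P Kt) 0 (SU N))) :
    ∀ (x : Site (F.P Kt) 0) (w : List (Letter (F.P Kt).d)), (∀ ν, netDisp w ν = 0) → holAt U (walk x w) = 1 := by
  rw [wilsonAction4_unit] at hA
  have h0 : wilsonAction4 U = 0 := le_antisymm hA (wilsonAction4_nonneg U)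
  exact holFlat_of_plaqHol_eq_one U (plaqHol_eq_one_of_wilsonAction4_eq_zero U h0)

/-- **THE CONSTRAINT `M˙U = M˙1` ON `𝔹` MAKES THE STRAIGHT TRANSPORTERS OF A HOLONOMY-FLAT `U` TRIVIAL**: the averaging of record is the (0.4) block averaging `blockAvg expMeanLogSU`, whose
iterate on a holonomy-flat configuration is its straight transporter between block centres (UST `iter_blockAvg_eq_straightIter_of_flat`, `ℰ(1,…,1) = 1`), and `M˙1`'s transporters are `1`.
[cite: Balaban1987RG1, (0.4) p.253, (0.11) p.253; Balaban1988Convergent, (2.10)–(2.12) p.256] -/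
theorem segments_of_agreeOn_one (𝔹 : DetSet (F.P Kt)) (U : GaugeField (F.P Kt) 0 (SU N))
    (hflat : ∀ (x : Site (F.P Kt) 0) (w : List (Letter (F.P Kt).d)), (∀ ν, netDisp w ν = 0) → holAt U (walk x w) = 1)
    (hagree : AgreeOn 𝔹 (avgFamily (avOfRecord F N Kt) U) (avgFamily (avOfRecord F N Kt) 1)) :
    ∀ j, ∀ c ∈ bondsOf (𝔹 j), holAt U (walk (embIter j c.src) (List.replicate ((F.P Kt).L ^ j) (c.dir, true))) = 1 := by
  intro j c hc
  have hflat1 : ∀ (x : Site (F.P Kt) 0) (w : List (Letter (F.P Kt).d)), (∀ ν, netDisp w ν = 0) → holAt (1 : GaugeField (F.P Kt) 0 (SU N)) (walk x w) = 1 :=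
    fun _ _ _ => holAt_one_eq_one' _
  have ha : Averaging.iter (fun i => (blockAvg expMeanLogSU : Averaging (F.P Kt) i (SU N))) j U c =
      Averaging.iter (fun i => (blockAvg expMeanLogSU : Averaging (F.P Kt) i (SU N))) j 1 c := hagree j c hc
  rw [iter_blockAvg_eq_straightIter_of_flat expMeanLogSU T3DescentFibreTower.expMeanLogSU_E_one U hflat j,
    iter_blockAvg_eq_straightIter_of_flat expMeanLogSU T3DescentFibreTower.expMeanLogSU_E_one 1 hflat1 j] at ha
  dsimp only at ha
  rw [holAt_one_eq_one'] at ha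
  exact ha

/-- **THE LETTER BUDGET AT THE RECORD**: `d = 4`, `L ≥ 13`, `k + 1 ≤ m + K` give `(d+3)·Lᵏ ≤ 2L^{m+K} = |T_η|` per direction. [cite: Balaban1987RG1, (0.1) p.251 (bookkeeping)] -/
theorem letterBudget_atRecord {k : ℕ} (hkK : k + 1 ≤ (F.P Kt).m + (F.P Kt).K) : ((F.P Kt).d + 3) * (F.P Kt).L ^ k ≤ (F.P Kt).sitesPerDir 0 := by
  have hd : (F.P Kt).d = 4 := T4Continuum.T4Family.P_d F Kt
  have hL : 11 < (F.P Kt).L := F.hL11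
  rw [hd]
  unfold Params.sitesPerDir
  rw [Nat.sub_zero]
  have h1 : (F.P Kt).L ^ (k + 1) ≤ (F.P Kt).L ^ ((F.P Kt).m + (F.P Kt).K) := Nat.pow_le_pow_right (by omega) hkK
  have h2 : (4 + 3) * (F.P Kt).L ^ k ≤ (F.P Kt).L ^ (k + 1) := by
    rw [pow_succ]
    nlinarith [Nat.one_le_pow k (F.P Kt).L (by omega)]
  omega

/-- ★★★ **THE (T1@q₀)-CENTRAL ROW OF THE (J0′) PRODUCER OF RECORD HOLDS AT THE FLAT BASE FIELD** (`V_k ≡ 1`, `U₀ := 1`, `𝔹 := 𝐁_k(Z)`, every reading class `reg′`): for every `U` with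
the unit datum `M˙U = M˙(Q_k^{s*}(ext 1))` on `𝐁_k(Z)` and `A U ≤ A 1` there is a gauge transformation `u`, EQUAL and CENTRAL (indeed `= 1`) at the two tower sites of every constrained bond,
with `U^u = 1`.  Record numerics: `0 < k`, `k + 1 ≤ m + K`, `4L ≤ M₁`, `LᵏM₁ ∣ 2L^{m+K}` (the producer's own binders `hk0 hkK hM4 hdiv`).
[cite: Balaban1985Variational, Thm 1 p.279, (3)–(4) p.278; Balaban1988Convergent, (2.2) p.255, (2.10)–(2.13) pp.256–257; Balaban1989LargeFieldI, p.193, Prop. 1 p.194] -/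
theorem thm1Row_one_at_flatDatum (ν : Node00.Stage7Numerics) (Kt : ℕ) (Z : Set (Site (F.P Kt) 0)) {k : ℕ}
    (hkK : k + 1 ≤ (F.P Kt).m + (F.P Kt).K) (hk0 : 0 < k) (hM4 : 4 * (F.P Kt).L ≤ ν.M₁) (hdiv : side (F.P Kt).L ν.M₁ k ∣ (F.P Kt).sitesPerDir 0)
    (Λ : Set (Site (F.P Kt) k)) (lo hi : Fin (F.P Kt).d → ℤ)
    (ext : GaugeField (F.P Kt) k (SU 2) → GaugeField (F.P Kt) k (SU 2)) (hext : ∀ W, ext W = extend Λ (shellGauge W lo hi) W)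
    (reg' : Set (GaugeField (F.P Kt) 0 (SU 2))) :
    ∀ U ∈ reg', AgreeOn (Bj ν.M₁ Z k) (avgFamily (avOfRecord F 2 Kt) U) (avgFamily (avOfRecord F 2 Kt) (qsstarGIter0 k (ext 1))) →
      wilsonAction4 U ≤ wilsonAction4 (1 : GaugeField (F.P Kt) 0 (SU 2)) →
      ∃ u : GaugeTransf (F.P Kt) 0 (SU 2), (∀ j, j ≤ k → ∀ b ∈ bondsOf (Bj ν.M₁ Z k j),
        toMS u j b.src = toMS u j b.tgt ∧ ∀ g : SU 2, toMS u j b.src * g = g * toMS u j b.src) ∧ gaugeAct u U = 1 := by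
  intro U _ hagree hA
  rw [ext_one Λ lo hi ext hext, qsstarGIter0_one] at hagree
  have hflat := holFlat_of_wilsonAction4_le_one U hA
  have hseg := segments_of_agreeOn_one (Bj ν.M₁ Z k) U hflat hagree
  have hL := (F.P Kt).L_pos
  exact exists_towerCentral_gauge_to_one_of_flat_segments (by omega) hk0 (by omega) hdiv (letterBudget_atRecord hkK) U hflat
    (fun j _ c hc => hseg j c hc)

/-- ★ **(E) AT THE FLAT BASE FIELD WITH `U₀ := 1`**, modulo the DISPLAYED membership of the flat configuration in the class: `1` minimises (2.12) for its own datum `M˙(Q_k^{s*}(ext 1)) = M˙1`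
on every determining set (dag-n12-e's `isMinimizer_one_avgFamily_one`). [cite: Balaban1988Convergent, (2.12) p.256; Balaban1989LargeFieldI, p.193] -/
theorem isMinimizer_one_at_flatDatum {k : ℕ} (𝔹 : DetSet (F.P Kt)) (reg : Set (GaugeField (F.P Kt) 0 (SU N))) (h1 : (1 : GaugeField (F.P Kt) 0 (SU N)) ∈ reg)
    (Λ : Set (Site (F.P Kt) k)) (lo hi : Fin (F.P Kt).d → ℤ)
    (ext : GaugeField (F.P Kt) k (SU N) → GaugeField (F.P Kt) k (SU N)) (hext : ∀ W, ext W = extend Λ (shellGauge W lo hi) W) :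
    IsMinimizer (avOfRecord F N Kt) reg 𝔹 (avgFamily (avOfRecord F N Kt) (qsstarGIter0 k (ext 1))) 1 := by
  rw [ext_one Λ lo hi ext hext, qsstarGIter0_one]
  exact isMinimizer_one_avgFamily_one _ h1 𝔹

/-- ★★ **BOTH MINIMISER ROWS OF THE (J0′) PRODUCER AT THE FLAT BASE FIELD, `U₀ := 1`** (modulo `1 ∈ class`): (E) and (T1@q₀) together, in the producer's order, for `𝔹 := 𝐁_k(Z)`.
[cite: Balaban1985Variational, Thm 1 p.279; Balaban1988Convergent, (2.12)–(2.13) pp.256–257; Balaban1989LargeFieldI, Prop. 1 p.194] -/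
theorem minimiserRows_one_at_flatDatum (ν : Node00.Stage7Numerics) (Kt : ℕ) (Z : Set (Site (F.P Kt) 0)) {k : ℕ}
    (hkK : k + 1 ≤ (F.P Kt).m + (F.P Kt).K) (hk0 : 0 < k) (hM4 : 4 * (F.P Kt).L ≤ ν.M₁) (hdiv : side (F.P Kt).L ν.M₁ k ∣ (F.P Kt).sitesPerDir 0)
    (Λ : Set (Site (F.P Kt) k)) (lo hi : Fin (F.P Kt).d → ℤ)
    (ext : GaugeField (F.P Kt) k (SU 2) → GaugeField (F.P Kt) k (SU 2)) (hext : ∀ W, ext W = extend Λ (shellGauge W lo hi) W)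
    (reg : Set (GaugeField (F.P Kt) 0 (SU 2))) (h1 : (1 : GaugeField (F.P Kt) 0 (SU 2)) ∈ reg) (reg' : Set (GaugeField (F.P Kt) 0 (SU 2))) :
    IsMinimizer (avOfRecord F 2 Kt) reg (Bj ν.M₁ Z k) (avgFamily (avOfRecord F 2 Kt) (qsstarGIter0 k (ext 1))) 1 ∧
    ∀ U ∈ reg', AgreeOn (Bj ν.M₁ Z k) (avgFamily (avOfRecord F 2 Kt) U) (avgFamily (avOfRecord F 2 Kt) (qsstarGIter0 k (ext 1))) →
      wilsonAction4 U ≤ wilsonAction4 (1 : GaugeField (F.P Kt) 0 (SU 2)) →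
      ∃ u : GaugeTransf (F.P Kt) 0 (SU 2), (∀ j, j ≤ k → ∀ b ∈ bondsOf (Bj ν.M₁ Z k j),
        toMS u j b.src = toMS u j b.tgt ∧ ∀ g : SU 2, toMS u j b.src * g = g * toMS u j b.src) ∧ gaugeAct u U = 1 :=
  ⟨isMinimizer_one_at_flatDatum (Bj ν.M₁ Z k) reg h1 Λ lo hi ext hext, thm1Row_one_at_flatDatum ν Kt Z hkK hk0 hM4 hdiv Λ lo hi ext hext reg'⟩

/-- ★★ **(E) AT THE FLAT BASE FIELD FOR THE CLASS OF RECORD, `U₀ := 1`** (`εreg > 0`; no displayed membership): `1` minimises (2.12) over `regMSCoPOfRecord` for the datum `M˙(Q_k^{s*}(ext 1))`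
on every determining set — the (E) row of the (J0′) producer of record at `V_k ≡ 1`. [cite: Balaban1988Convergent, (2.12)–(2.13) pp.256–257; Balaban1985Variational, Thm 1 p.279, (2) p.278] -/
theorem isMinimizer_one_at_flatDatum_ofRecord (ν : Node00.Stage7Numerics) (hreg : 0 < ν.εreg) (K' : ℕ) (Ω : ℕ → Set (Site (F.P Kt) 0)) {k : ℕ} (𝔹 : DetSet (F.P Kt))
    (Λ : Set (Site (F.P Kt) k)) (lo hi : Fin (F.P Kt).d → ℤ)
    (ext : GaugeField (F.P Kt) k (SU N) → GaugeField (F.P Kt) k (SU N)) (hext : ∀ W, ext W = extend Λ (shellGauge W lo hi) W) :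
    IsMinimizer (avOfRecord F N Kt) (Node00.regMSCoPOfRecord F N ν Kt K' Ω) 𝔹 (avgFamily (avOfRecord F N Kt) (qsstarGIter0 k (ext 1))) 1 :=
  isMinimizer_one_at_flatDatum 𝔹 _ (one_mem_regMSCoPOfRecord ν hreg Kt K' Ω) Λ lo hi ext hext

/-- ★★★ **BOTH MINIMISER ROWS OF THE (J0′) PRODUCER OF RECORD AT THE FLAT BASE FIELD, `U₀ := 1`, NOTHING DISPLAYED BUT THE RECORD NUMERICS** (`0 < εreg`, `0 < k`, `k + 1 ≤ m + K`,
`4L ≤ M₁`, `LᵏM₁ ∣ 2L^{m+K}`): (E) over the class of record `regMSCoPOfRecord … (maxDomT ν.M₁ Z)` and (T1@q₀) for every reading class `reg′`, at `𝔹 := 𝐁_k(Z)` — the BC5-style non-vacuity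
certificate, at the flat base field, of the two rows of «(J0′) OF RECORD» that speak about the unknown minimiser.
[cite: Balaban1985Variational, Thm 1 p.279; Balaban1988Convergent, (2.12)–(2.13) pp.256–257; Balaban1989LargeFieldI, Prop. 1 p.194] -/
theorem minimiserRows_one_at_flatDatum_ofRecord (ν : Node00.Stage7Numerics) (hreg : 0 < ν.εreg) (Kt : ℕ) (Z : Set (Site (F.P Kt) 0)) {k : ℕ}
    (hkK : k + 1 ≤ (F.P Kt).m + (F.P Kt).K) (hk0 : 0 < k) (hM4 : 4 * (F.P Kt).L ≤ ν.M₁) (hdiv : side (F.P Kt).L ν.M₁ k ∣ (F.P Kt).sitesPerDir 0)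
    (Λ : Set (Site (F.P Kt) k)) (lo hi : Fin (F.P Kt).d → ℤ)
    (ext : GaugeField (F.P Kt) k (SU 2) → GaugeField (F.P Kt) k (SU 2)) (hext : ∀ W, ext W = extend Λ (shellGauge W lo hi) W)
    (reg' : Set (GaugeField (F.P Kt) 0 (SU 2))) :
    IsMinimizer (avOfRecord F 2 Kt) (Node00.regMSCoPOfRecord F 2 ν Kt k (maxDomT ν.M₁ Z)) (Bj ν.M₁ Z k) (avgFamily (avOfRecord F 2 Kt) (qsstarGIter0 k (ext 1))) 1 ∧
    ∀ U ∈ reg', AgreeOn (Bj ν.M₁ Z k) (avgFamily (avOfRecord F 2 Kt) U) (avgFamily (avOfRecord F 2 Kt) (qsstarGIter0 k (ext 1))) →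
      wilsonAction4 U ≤ wilsonAction4 (1 : GaugeField (F.P Kt) 0 (SU 2)) →
      ∃ u : GaugeTransf (F.P Kt) 0 (SU 2), (∀ j, j ≤ k → ∀ b ∈ bondsOf (Bj ν.M₁ Z k j),
        toMS u j b.src = toMS u j b.tgt ∧ ∀ g : SU 2, toMS u j b.src * g = g * toMS u j b.src) ∧ gaugeAct u U = 1 :=
  ⟨isMinimizer_one_at_flatDatum_ofRecord ν hreg k (maxDomT ν.M₁ Z) (Bj ν.M₁ Z k) Λ lo hi ext hext,
    thm1Row_one_at_flatDatum ν Kt Z hkK hk0 hM4 hdiv Λ lo hi ext hext reg'⟩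

end Record

end Summit.QuantumFields.YangMills.BalabanUVNodes.N12Thm1RowAtFlatDatum

end
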